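import Summits.ABC.ABC.Theses.AntisymmetricTwoTorsion
import Summits.ABC.ABC.Theses.GaussianTwoDivision
import Literature.NumberTheory.EllipticCurves.IntegralModelMinimalScalingProofs
import Literature.NumberTheory.EllipticCurves.SzpiroFreyProofs
import Literature.NumberTheory.DiophantineGeometry.MinimalDiscriminantFactorizationProofs
import Literature.NumberTheory.DiophantineGeometry.ConductorFactorizationProofs
import HarnessLib

/-!
# The two-torsion dictionary: Tate's algorithm away from `2` for `y² = x (x² + a x + b)`

Route-directed Theorems file of summit `ABC`, closing the SHARED support item stmt-ABC-23398
`TwoTorsionDictionary` of the routes `AntisymmetricTwoTorsion` and `GaussianTwoDivision`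
(abc-idea-1 g2; critic idea-crit-6, 2026-08-27: "REUSABLE — worth landing on its own merits").

**Statement.** For coprime integers `a, b` with `b (a² − 4b) ≠ 0` and every elliptic
`W = ⟨0, a, 0, b, 0⟩ / ℚ` (the curve `y² = x (x² + a x + b)` with the rational two-torsion point
`(0, 0)`):

* `|Δ_min (W)| ≤ |16 b² (a² − 4b)|` — the right-hand side is `|Δ|` of the integral equation
  `⟨0, a, 0, b, 0⟩ / ℤ` (`Δ_eq`), and the minimal discriminant divides the discriminant of any
  integral equation (Silverman, AEC VII.1, Remark 1.1; in the tree
  `Literature.NumberTheory.EllipticCurves.exists_ordMinimalDiscriminant_add_eq_padicValInt`);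
* `rad (b (a² − 4b)) ∣ 2 · N_W` — at an ODD prime `p ∣ b (a² − 4b)` one has `p ∤ c₄ = 16 (a² − 3b)`
  (`gcd (a, b) = 1`: if `p ∣ b` then `a² − 3b ≡ a² ≢ 0`; if `p ∣ a² − 4b` then `a² − 3b ≡ b ≢ 0`), so
  the integral equation is minimal at `p` with multiplicative (nodal) reduction, `f_p = 1`, `p ∣ N_W`
  (Tate's algorithm / Silverman AEC VII.5.1(b), ATAEC IV.10.2(b); Bombieri–Gubler 12.5.9(b); in the
  tree `WeierstrassCurve.conductorExponent_eq_one_of_dvd_Δ_of_not_dvd_c₄`); the prime `2` is absorbed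
  by the factor `2`.

This is the same local bookkeeping as for the Frey curve `y² = x (x − A) (x + B)` (the split case
`x² + a x + b = (x − A) (x + B)`, Bombieri–Gubler Ex. 12.5.10, tree
`Literature.NumberTheory.EllipticCurves.conductorNorm_freyCurve_dvd_holds`) and for Bennett–Skinner's
`(n, n, 2)` Frey curves `⟨0, 2cC, 0, BCbⁿ, 0⟩` (Bennett–Skinner 2004, Lemma 2.1).

HONESTY. A library lemma on a thin two-torsion class; it moves no rung of LADDER-ABC (A0 / A-PS /
A1′ unchanged); abc is not proved by any of this; A-PS (polynomial Szpiro) is NOT abc.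

## References

* J. H. Silverman, *The Arithmetic of Elliptic Curves*, GTM 106, 2nd ed. 2009, VII.1 Remark 1.1,
  VII.5 Prop. 5.1(b), VIII.8. [SilvermanAEC2009]
* E. Bombieri, W. Gubler, *Heights in Diophantine Geometry*, CUP 2006, 12.5.9–12.5.10.
  [BombieriGubler2006]
* M. A. Bennett, C. M. Skinner, *Ternary Diophantine equations via Galois representations and
  modular forms*, Canad. J. Math. 56 (2004), Lemma 2.1. [BennettSkinner2004]
-/

-- `Summit.<Summit>.<Problem>` is the mandated summit-side namespace (CONVENTIONS §2); for the
-- single-conjunct summit `ABC` the two coincide, so the duplicate `ABC.ABC` is deliberate.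
set_option linter.dupNamespace false

namespace Summit.ABC.ABC.Theorems

open IsDedekindDomain WeierstrassCurve Rat.HeightOneSpectrum UniqueFactorizationMonoid
open Literature.NumberTheory.EllipticCurves Literature.NumberTheory.DiophantineGeometry

namespace TwoTorsionDictionary

/-! ### The integral equation `⟨0, a, 0, b, 0⟩ / ℤ` -/

/-- `c₄ = 16 (a² − 3b)` for the integral equation `y² = x³ + a x² + b x`. [folklore] -/
theorem c₄_eq (a b : ℤ) : (⟨0, a, 0, b, 0⟩ : WeierstrassCurve ℤ).c₄ = 16 * (a ^ 2 - 3 * b) := by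
  simp only [WeierstrassCurve.c₄, WeierstrassCurve.b₂, WeierstrassCurve.b₄]
  ring

/-- `Δ = 16 b² (a² − 4b)` for the integral equation `y² = x³ + a x² + b x`. [folklore] -/
theorem Δ_eq (a b : ℤ) :
    (⟨0, a, 0, b, 0⟩ : WeierstrassCurve ℤ).Δ = 16 * b ^ 2 * (a ^ 2 - 4 * b) := by
  simp only [WeierstrassCurve.Δ, WeierstrassCurve.b₂, WeierstrassCurve.b₄, WeierstrassCurve.b₆,
    WeierstrassCurve.b₈]
  ring

/-- `⟨0, a, 0, b, 0⟩ / ℤ` base-changed to `ℚ` is `⟨0, a, 0, b, 0⟩ / ℚ`. [folklore] -/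
theorem baseChange_eq (a b : ℤ) :
    (⟨0, a, 0, b, 0⟩ : WeierstrassCurve ℤ).baseChange ℚ = ⟨0, (a : ℚ), 0, (b : ℚ), 0⟩ := by
  ext <;> simp [WeierstrassCurve.baseChange, WeierstrassCurve.map]

/-! ### `|Δ_min| ∣ |Δ (W₀)|` for an integral equation -/

/-- **Silverman, AEC VII.1 Remark 1.1 / VIII.8**: the minimal discriminant of an elliptic curve
over `ℚ` divides (in `ℕ`, through absolute values) the discriminant of ANY of its integral
Weierstrass equations `W₀ / ℤ`: prime by prime `ord_p (Δ_min) ≤ ord_p (Δ (W₀))`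
(`exists_ordMinimalDiscriminant_add_eq_padicValInt`) and `|Δ_min| = ∏ p ^ ord_p (Δ_min)`
(`factorization_minimalDiscriminantNorm_holds`). [cite: SilvermanAEC2009, VII.1 Remark 1.1] -/
theorem minimalDiscriminantNorm_dvd_natAbs_Δ (W₀ : WeierstrassCurve ℤ)
    [(W₀.baseChange ℚ).IsElliptic] :
    (W₀.baseChange ℚ).minimalDiscriminantNorm ℤ ∣ W₀.Δ.natAbs := by
  have hΔ0 : W₀.Δ ≠ 0 := Δ_ne_zero_of_isElliptic_baseChange_int W₀
  have hD0 : (W₀.baseChange ℚ).minimalDiscriminantNorm ℤ ≠ 0 :=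
    (minimalDiscriminantNorm_pos_holds _).ne'
  rw [← Nat.factorization_le_iff_dvd hD0 (Int.natAbs_ne_zero.mpr hΔ0)]
  intro p
  by_cases hp : p.Prime
  · obtain ⟨v, hv⟩ := exists_place ⟨p, hp⟩
    have hfac := factorization_minimalDiscriminantNorm_holds (W₀.baseChange ℚ) v
    obtain ⟨k, hk, -, -⟩ := exists_ordMinimalDiscriminant_add_eq_padicValInt v W₀
    haveI : Fact (natGenerator v).Prime := ⟨prime_natGenerator v⟩
    have hval : padicValInt (natGenerator v) W₀.Δ = W₀.Δ.natAbs.factorization (natGenerator v) := by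
      rw [padicValInt, Nat.factorization_def _ (prime_natGenerator v)]
    simp only at hv
    rw [← hv, hfac, ← hval]
    omega
  · simp [Nat.factorization_eq_zero_of_not_prime _ hp]

/-! ### Odd primes of `b (a² − 4b)` are multiplicative -/

/-- For coprime `a, b` and a prime `p ∣ b (a² − 4b)`: `p ∤ a² − 3b` (if `p ∣ b` then
`a² − 3b ≡ a²` and `p ∤ a`; if `p ∣ a² − 4b` then `a² − 3b ≡ b`, and `p ∣ b` would again force
`p ∣ a`). [folklore] -/
theorem not_dvd_sq_sub_three_mul {a b : ℤ} (hab : IsCoprime a b) {p : ℕ} (hp : p.Prime)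
    (h : (p : ℤ) ∣ b * (a ^ 2 - 4 * b)) : ¬ (p : ℤ) ∣ a ^ 2 - 3 * b := by
  intro hc
  have hpint : Prime (p : ℤ) := Nat.prime_iff_prime_int.mp hp
  -- in both cases `p ∣ b`
  have hpb : (p : ℤ) ∣ b := by
    rcases hpint.dvd_or_dvd h with hb | hd
    · exact hb
    · have h1 : (p : ℤ) ∣ (a ^ 2 - 3 * b) - (a ^ 2 - 4 * b) := dvd_sub hc hd
      have h2 : (a ^ 2 - 3 * b) - (a ^ 2 - 4 * b) = b := by ring
      rwa [h2] at h1
  -- hence `p ∣ a² = (a² − 3b) + 3b`, `p ∣ a`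
  have hpa2 : (p : ℤ) ∣ a ^ 2 := by
    have h1 : (p : ℤ) ∣ (a ^ 2 - 3 * b) + 3 * b := dvd_add hc (dvd_mul_of_dvd_right hpb 3)
    have h2 : (a ^ 2 - 3 * b) + 3 * b = a ^ 2 := by ring
    rwa [h2] at h1
  have hpa : (p : ℤ) ∣ a := hpint.dvd_of_dvd_pow hpa2
  exact hpint.not_unit (hab.isUnit_of_dvd' hpa hpb)

/-- For coprime `a, b` and an ODD prime `p ∣ b (a² − 4b)`: `p ∤ c₄ (⟨0, a, 0, b, 0⟩) = 16 (a² − 3b)`.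
[folklore] -/
theorem not_dvd_c₄ {a b : ℤ} (hab : IsCoprime a b) {p : ℕ} (hp : p.Prime) (hp2 : p ≠ 2)
    (h : (p : ℤ) ∣ b * (a ^ 2 - 4 * b)) :
    ¬ (p : ℤ) ∣ (⟨0, a, 0, b, 0⟩ : WeierstrassCurve ℤ).c₄ := by
  rw [c₄_eq]
  intro hc
  rcases (Nat.prime_iff_prime_int.mp hp).dvd_or_dvd hc with h16 | h3
  · exact hp2 (eq_two_of_dvd_sixteen hp h16)
  · exact not_dvd_sq_sub_three_mul hab hp h h3

/-- **Tate's algorithm away from `2`** (Silverman AEC VII.5.1(b), ATAEC IV.10.2(b);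
Bombieri–Gubler 12.5.9(b)): for coprime `a, b` with `W₀ = ⟨0, a, 0, b, 0⟩ / ℤ` elliptic over `ℚ`
and an odd prime `p ∣ b (a² − 4b)`, the equation is minimal at `p` with multiplicative reduction,
so `f_p = 1` and `p ∣ N`. [cite: SilvermanAEC2009, VII.5 Prop. 5.1(b)] -/
theorem dvd_conductorNorm_of_odd_prime {a b : ℤ} (hab : IsCoprime a b)
    [((⟨0, a, 0, b, 0⟩ : WeierstrassCurve ℤ).baseChange ℚ).IsElliptic] {p : ℕ} (hp : p.Prime)
    (hp2 : p ≠ 2) (h : (p : ℤ) ∣ b * (a ^ 2 - 4 * b)) :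
    p ∣ ((⟨0, a, 0, b, 0⟩ : WeierstrassCurve ℤ).baseChange ℚ).conductorNorm ℤ := by
  set W₀ : WeierstrassCurve ℤ := ⟨0, a, 0, b, 0⟩ with hW₀
  obtain ⟨v, hv⟩ := exists_place ⟨p, hp⟩
  simp only at hv
  have hc₄ : ¬ (natGenerator v : ℤ) ∣ W₀.c₄ := by
    rw [hv]; exact not_dvd_c₄ hab hp hp2 h
  have hΔ : (natGenerator v : ℤ) ∣ W₀.Δ := by
    rw [hv, hW₀, Δ_eq]
    rcases (Nat.prime_iff_prime_int.mp hp).dvd_or_dvd h with hb | hd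
    · exact dvd_mul_of_dvd_left (dvd_mul_of_dvd_right (dvd_pow hb two_ne_zero) _) _
    · exact dvd_mul_of_dvd_right hd _
  have hmin : (W₀.baseChange ℚ).IsMinimalAt v := isMinimalAt_baseChange_int_of_not_dvd_c₄ hc₄
  have hf : (W₀.baseChange ℚ).conductorExponent v = 1 :=
    conductorExponent_eq_one_of_dvd_Δ_of_not_dvd_c₄ hmin hΔ hc₄
  have hfac := factorization_conductorNorm_holds (W₀.baseChange ℚ) v
  rw [hv, hf] at hfac
  have hN : (W₀.baseChange ℚ).conductorNorm ℤ ≠ 0 := (conductorNorm_pos_holds (W₀.baseChange ℚ)).ne'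
  exact (hp.dvd_iff_one_le_factorization hN).mpr hfac.ge

/-- A radical divides `M ≠ 0` as soon as every prime of `n ≠ 0` divides `M` (`rad n` is the
product of the distinct primes of `n`). [folklore] -/
theorem radical_dvd_of_forall_prime_dvd {n M : ℕ} (hn : n ≠ 0) (hM : M ≠ 0)
    (h : ∀ p : ℕ, p.Prime → p ∣ n → p ∣ M) : radical n ∣ M := by
  rw [← Nat.factorization_le_iff_dvd radical_ne_zero hM]
  intro p
  by_cases hp : p.Prime
  · rw [factorization_radical_apply hn hp]
    split_ifs with hpn
    · exact (hp.dvd_iff_one_le_factorization hM).mp (h p hp hpn)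
    · exact Nat.zero_le _
  · simp [Nat.factorization_eq_zero_of_not_prime _ hp]

/-- **The dictionary, conductor half**: for coprime `a, b` with `b (a² − 4b) ≠ 0` and
`⟨0, a, 0, b, 0⟩` elliptic over `ℚ`, `rad (b (a² − 4b)) ∣ 2 · N` (odd primes by
`dvd_conductorNorm_of_odd_prime`, the prime `2` by the factor `2`).
[cite: SilvermanAEC2009, VII.5 Prop. 5.1(b)] -/
theorem radical_natAbs_dvd_two_mul_conductorNorm {a b : ℤ} (hab : IsCoprime a b) (hb : b ≠ 0)
    (hd : a ^ 2 - 4 * b ≠ 0) [((⟨0, a, 0, b, 0⟩ : WeierstrassCurve ℤ).baseChange ℚ).IsElliptic] :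
    (radical (b * (a ^ 2 - 4 * b))).natAbs ∣
      2 * ((⟨0, a, 0, b, 0⟩ : WeierstrassCurve ℤ).baseChange ℚ).conductorNorm ℤ := by
  set m : ℤ := b * (a ^ 2 - 4 * b) with hm
  have hm0 : m.natAbs ≠ 0 := Int.natAbs_ne_zero.mpr (mul_ne_zero hb hd)
  have hrad : (radical m).natAbs = radical m.natAbs := by
    rw [← Int.radical_natAbs_eq_radical, Int.natAbs_natCast]
  rw [hrad]
  have hN : ((⟨0, a, 0, b, 0⟩ : WeierstrassCurve ℤ).baseChange ℚ).conductorNorm ℤ ≠ 0 :=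
    (conductorNorm_pos_holds _).ne'
  refine radical_dvd_of_forall_prime_dvd hm0 (mul_ne_zero two_ne_zero hN) fun p hp hpm ↦ ?_
  by_cases hp2 : p = 2
  · subst hp2; exact dvd_mul_right 2 _
  · exact dvd_mul_of_dvd_right
      (dvd_conductorNorm_of_odd_prime hab hp hp2 (Int.natCast_dvd.mpr hpm)) 2

/-- **The dictionary, discriminant half**: `|Δ_min (W)| ≤ |16 b² (a² − 4b)|` as real numbers for
`W = ⟨0, a, 0, b, 0⟩ ⊗ ℚ` elliptic. [cite: SilvermanAEC2009, VII.1 Remark 1.1] -/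
theorem cast_minimalDiscriminantNorm_le (a b : ℤ)
    [((⟨0, a, 0, b, 0⟩ : WeierstrassCurve ℤ).baseChange ℚ).IsElliptic] :
    ((((⟨0, a, 0, b, 0⟩ : WeierstrassCurve ℤ).baseChange ℚ).minimalDiscriminantNorm ℤ : ℕ) : ℝ) ≤
      |(16 : ℝ) * (b : ℝ) ^ 2 * ((a : ℝ) ^ 2 - 4 * (b : ℝ))| := by
  set W₀ : WeierstrassCurve ℤ := ⟨0, a, 0, b, 0⟩ with hW₀
  have hΔ0 : W₀.Δ ≠ 0 := Δ_ne_zero_of_isElliptic_baseChange_int W₀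
  have h1 : (W₀.baseChange ℚ).minimalDiscriminantNorm ℤ ≤ W₀.Δ.natAbs :=
    Nat.le_of_dvd (Int.natAbs_pos.mpr hΔ0) (minimalDiscriminantNorm_dvd_natAbs_Δ W₀)
  have h2 : ((W₀.Δ.natAbs : ℕ) : ℝ) = |(16 : ℝ) * (b : ℝ) ^ 2 * ((a : ℝ) ^ 2 - 4 * (b : ℝ))| := by
    rw [Nat.cast_natAbs, hW₀, Δ_eq]
    push_cast
    rfl
  rw [← h2]
  exact_mod_cast h1

/-- **The two-torsion dictionary** (unfolded form shared by both route decls): for coprime `a, b`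
with `b ≠ 0`, `a² − 4b ≠ 0` and every elliptic `W = ⟨0, a, 0, b, 0⟩ / ℚ`,
`|Δ_min (W)| ≤ |16 b² (a² − 4b)|` and `rad (b (a² − 4b)) ∣ 2 · N_W`.
[cite: SilvermanAEC2009, VII.1 Remark 1.1 and VII.5 Prop. 5.1(b)] -/
theorem twoTorsionDictionary (a b : ℤ) (hab : IsCoprime a b) (hb : b ≠ 0) (hd : a ^ 2 - 4 * b ≠ 0)
    (W : WeierstrassCurve ℚ) [W.IsElliptic] (hW : W = ⟨0, (a : ℚ), 0, (b : ℚ), 0⟩) :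
    (W.minimalDiscriminantNorm ℤ : ℝ) ≤ |(16 : ℝ) * (b : ℝ) ^ 2 * ((a : ℝ) ^ 2 - 4 * (b : ℝ))| ∧
      (radical (b * (a ^ 2 - 4 * b))).natAbs ∣ 2 * W.conductorNorm ℤ := by
  have hW' : W = (⟨0, a, 0, b, 0⟩ : WeierstrassCurve ℤ).baseChange ℚ := hW.trans (baseChange_eq a b).symm
  subst hW'
  exact ⟨cast_minimalDiscriminantNorm_le a b, radical_natAbs_dvd_two_mul_conductorNorm hab hb hd⟩

end TwoTorsionDictionary

/-- **Closes stmt-ABC-23398 for route `AntisymmetricTwoTorsion`**: the two-torsion dictionary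
`Summit.ABC.ABC.Theses.AntisymmetricTwoTorsion.TwoTorsionDictionary` (Tate's algorithm away from
`2` for `y² = x (x² + a x + b)`, `gcd (a, b) = 1`). Library lemma; NOT abc, moves no rung.
[cite: SilvermanAEC2009, VII.1 Remark 1.1 and VII.5 Prop. 5.1(b)] -/
theorem twoTorsionDictionary_proof :
    Summit.ABC.ABC.Theses.AntisymmetricTwoTorsion.TwoTorsionDictionary := by
  unfold Summit.ABC.ABC.Theses.AntisymmetricTwoTorsion.TwoTorsionDictionary
  intro a b hab hb hd W _ hW
  exact TwoTorsionDictionary.twoTorsionDictionary a b hab hb hd W hW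

/-- **Closes stmt-ABC-23398 for route `GaussianTwoDivision`** (the same shared item, identical
signature): `Summit.ABC.ABC.Theses.GaussianTwoDivision.TwoTorsionDictionary`. Library lemma; NOT
abc, moves no rung. [cite: SilvermanAEC2009, VII.1 Remark 1.1 and VII.5 Prop. 5.1(b)] -/
theorem gaussianTwoDivision_twoTorsionDictionary_proof :
    Summit.ABC.ABC.Theses.GaussianTwoDivision.TwoTorsionDictionary := by
  unfold Summit.ABC.ABC.Theses.GaussianTwoDivision.TwoTorsionDictionary
  intro a b hab hb hd W _ hW
  exact TwoTorsionDictionary.twoTorsionDictionary a b hab hb hd W hW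

end Summit.ABC.ABC.Theorems
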